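import Summits.QuantumFields.YangMills.Theorems.BalabanUVNodesN11TkBranchMassBoundCore
import Literature.MathematicalPhysics.QuantumFieldTheory.Balaban1983to89.Node00.TkFirstStepRegionVanishing

/-!
# DAG node N11 — A LINTEGRAL MASS BOUND THROUGH 11a's GENERATIONS: the old branches `U₀ ↦ 𝐓_k(s,S)[Φ](base_k U₀)` are `dU_k`-INTEGRABLE as soon as the
# operand is measurable and bounded and every generation's A-fibre weight is dominated by an integrable function of the integrated fluctuation variables
# (door (d3): the STRUCTURAL sufficient condition for the last binder `hIB` of N11's off-diagonal residue)

HEADER — WORK-UNIT METADATA.  Cell `pub-ymgap`, YM-PLAN Track A (HUMAN RULING D-0062), seat `pub-ymgap-dag-n11-d` (g10; R134 fan-out seat N11 [B14], strategy s2),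
route `BalabanUVNodes` rev 25, item K1⁷ `StabilityBAtRecordR13SepCoPH` = stmt-QuantumFields-20542 (helper, `--kind proof --supports 20542 --as helper`, count-neutral).
[III] = [Balaban1988Convergent].  Over `T4AveragingDisintegration` (`jointLaw`, `margDensity`, `condLaw`, `Measure.lintegral_condKernel`), 11a `Node00.TkOfRecord`
(`kernelRT`, `vOp`, `aOp`, `zetaOp`, `genOp`, `genDataOfRecord`, `tkBranchOfRecord`, `baseCfg`), r11's (2.1) chain (`Chain21.Ω_succ_subset`, `Λ_subset`), this seat's
C1 `…N11TkOpMeasurable` (measurability through the operator algebra) and g6 `Node00.TkFirstStepRegionVanishing` (`measurable_avgRestrOfRecord`).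

WHY THIS FILE.  After doors (d1) (fluctuation truncation) and (d2) (joint law carried by the averaging graph) the off-diagonal residue of N11's no-expansion
𝐓-step is ONE binder: `hIB`, the `dU_k`-integrability of the old branches `U₀ ↦ 𝐓_k(init s′, S)[exp A_k(init s′)](base_k U₀)` of the `SLaw` witness.  As typed it is an
opaque statement about a `k`-fold iterated kernel transport.  THIS FILE reduces it to STRUCTURAL LAWS of the data — the operand is measurable and bounded on the
multiscale configuration space; the `ζ`-weights lie in `[0, 1]`; each generation's A-fibre weight `w_j` is dominated by an integrable function `ŵ_j` of the fluctuation
variables it integrates — by a mass bound in `ℝ≥0∞` carried through 11a's generations: the V-factor's kernel transport satisfies the DISINTEGRATION INEQUALITY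
`∫⁻ h(z)·∫⁻ f(z,·) dcondLaw(z) dHaar(z) ≤ ∫⁻ f(Ū, U) dHaar(U)` with NO absolute continuity (the marginal density is the Radon–Nikodym derivative of the
absolutely continuous part), the A-factor is bounded by `∫⁻ ŵ_j · (inner)`, and the variables a generation produces (level-`(j+1)` bonds outside `Ω_{j+1}`) are all
integrated by the next generation or are final (the (2.1) nesting `Ω_{j+2} ⊆ Λ_{j+1} ⊆ Ω_{j+1}`), so the marginal densities are integrated against the Haar measures
they are densities for.  The induction is over TEMPLATES: measurable insertions of the produced variables into an arbitrary configuration, parametrised by an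
arbitrary measurable space — the shape that survives the passage to the next generation.

WHAT THIS FILE PROVES (0 `sorry`, 0 `def`; the generic measure theory is the sibling `…N11TkBranchMassBoundCore`).
§2 ★ `lintegral_genOp_genDataOfRecord_le` (one generation of record: mass over the produced variables ≤ fibre-dominated mass over the integrated ones, at any
   measurable TEMPLATE inserting the produced variables into an arbitrary configuration).  §3 `seqOfRecord_Ω_succ_succ_subset`, `sV'_subset_sV_succ` (nesting),
   `measurable_tkBranchOfRecord`, `tkBranchOfRecord_nonneg'`.  §4 ★★ `lintegral_tkBranchOfRecord_template_le` (the induction over templates).  §5 ★★★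
   `integrable_tkBranchOfRecord_baseCfg_of_dominated` (the consumer theorem: `hIB`'s shape).

HONEST FRAMING.  Helper lane of K1⁷; measure theory over the tree's own operators; nothing of Bałaban's is asserted.  The structural laws are DISPLAYED hypotheses
(print: boundedness of the effective action at the background on the spaces of record, (2.27)(iv)∕(2.31)∕(2.42) with (2.7); the Gaussian factor `exp(−½⟨A, 𝒬A⟩)`
of the fluctuation integrals with [I]'s positivity of `𝒬`; `0 ≤ ζ ≤ 1` for resummed characteristic functions) — checking them at the witness and weights of record is
node00-def-T∕K0b's.  N11 NOT discharged; K1⁷ NOT closed; counts unmoved (typed 28∕28 · discharged 5∕27).  One finite four-torus programme at fixed `ε = L^{−K}` —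
NOT ℝ⁴, NOT OS, NOT a mass gap, NOT Clay.  No `sorry`, `axiom`, `instance`, `notation`.
Sources (SHAPE only): [III] (2.1) p.254, (2.18) p.257, (2.20)–(2.22) p.258, (2.27)–(2.31) pp.259–260, (2.42) p.261, (3.23)–(3.24) p.270; [Balaban1985Averaging] (10) p.19.
-/

noncomputable section

open MeasureTheory ProbabilityTheory
open scoped BigOperators ENNReal NNReal

namespace Summit.QuantumFields.YangMills.Theorems.BalabanUVNodesN11TkBranchMassBound

open Literature.MathematicalPhysics.QuantumFieldTheory.Balaban1983to89 T4Continuum T4NestedCovariance T4AdjointCovariance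
open T4AveragingDisintegration (kernelTransport margDensity condLaw jointLaw measurable_margDensity jointLaw_fst measurable_graphMap)
open Node00 Node00.Tk
open BalabanUVNodesN11TkOpMeasurable (measurable_aOp measurable_tkOp measurable_genOp_genDataOfRecord measurable_baseCfg)
open BalabanUVNodesN11TkBranchMassBoundCore

universe u

/-! ## §2  ONE GENERATION OF RECORD: the mass of `𝐓^{(j)}Ψ` over the produced variables is at most the fibre-dominated mass of `Ψ` over the integrated ones -/

section Generation

variable {F : T4Family} {N : ℕ} [NeZero N] {V : Type} [NormedAddCommGroup V] [InnerProductSpace ℝ V] [FiniteDimensional ℝ V]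
  [MeasurableSpace V] [BorelSpace V]
variable (ν : Stage7Numerics) (M : ℕ) (g : ℕ → ℝ) (K : ℕ) (W : TkWeights F N V K)

/-- **★ THE ONE-GENERATION MASS INEQUALITY.**  Generation `j` of record for the sequence `s` and branch `S` (its bond finsets written out: integrated `sV_j` = level-`j`
bonds outside `Ω_{j+1}`, produced `sV′_j` = level-`(j+1)` bonds outside `Ω_{j+1}`, A-bonds `sA_j` = level-`j` bonds in `Λ_{j+1}ᶜ ∩ Ω_{j+1}`); a measurable TEMPLATE `τ`
inserting the produced variables `z` into an arbitrary configuration (parameter `c`) AT the level-`(j+1)` bonds of `sV′_j`; `0 ≤ ζ_j ≤ 1` measurable; `0 ≤ w_j` measurable and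
dominated on every configuration by `ŵ(A_j|_{sA_j})`; `Ψ ≥ 0` measurable.  Then the mass of `𝐓^{(j)}Ψ ∘ τ(c, ·)` over product Haar on `sV′_j` is at most
`∫⁻ dy ∫⁻ da ŵ(a)·ofReal(Ψ(τ(c, avg y)[V_j|_{sV} := y][A_j|_{sA} := a]))` over product Haar on `sV_j` and Lebesgue on `sA_j` — the V-factor by the disintegration inequality
(§0), the ζ·A-factor by fibre domination (§1). [cite: Balaban1988Convergent, (2.21) p.258, (3.23) p.270; Balaban1985Averaging, (10) p.19] -/
theorem lintegral_genOp_genDataOfRecord_le {n : ℕ} (s : SeqOfRecord F ν M g K n) (S : ℕ → Set (Site (F.P K) 0)) (j : ℕ)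
    {hdec : DecidableEq (PBond (F.P K) j)}
    (hζm : Measurable (W.ζ j (s.Ω (j + 1))ᶜ)) (hζ0 : ∀ ω, 0 ≤ W.ζ j (s.Ω (j + 1))ᶜ ω) (hζ1 : ∀ ω, W.ζ j (s.Ω (j + 1))ᶜ ω ≤ 1)
    (hwm : Measurable (W.w j (s.Λ (j + 1)) ((s.Λ (j + 1))ᶜ ∩ s.Ω (j + 1)) (S (j + 1))))
    (hw0 : ∀ ω, 0 ≤ W.w j (s.Λ (j + 1)) ((s.Λ (j + 1))ᶜ ∩ s.Ω (j + 1)) (S (j + 1)) ω)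
    (ŵ : (↥(Set.toFinite (B10Eq42TorusConstraint.bondsIn j ((s.Λ (j + 1))ᶜ ∩ s.Ω (j + 1)))).toFinset → V) → ℝ≥0∞)
    (hdom : ∀ ω, ENNReal.ofReal (W.w j (s.Λ (j + 1)) ((s.Λ (j + 1))ᶜ ∩ s.Ω (j + 1)) (S (j + 1)) ω) ≤ ŵ (fun b : ↥(Set.toFinite (B10Eq42TorusConstraint.bondsIn j ((s.Λ (j + 1))ᶜ ∩ s.Ω (j + 1)))).toFinset => (ω j).2 b))
    {Ψ : MultiCfg (F.P K) (SU N) V → ℝ} (hΨm : Measurable Ψ) (hΨ0 : ∀ ω, 0 ≤ Ψ ω)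
    {Γ : Type} [MeasurableSpace Γ] (τ : Γ × (↥(Set.toFinite (B10Eq42TorusConstraint.bondsIn (j + 1) (s.Ω (j + 1))ᶜ)).toFinset → SU N) → MultiCfg (F.P K) (SU N) V) (hτ : Measurable τ)
    (hτz : ∀ c z, (fun b : ↥(Set.toFinite (B10Eq42TorusConstraint.bondsIn (j + 1) (s.Ω (j + 1))ᶜ)).toFinset => ((τ (c, z)) (j + 1)).1 b) = z) (c : Γ) :
    ∫⁻ z, ENNReal.ofReal (genOp j (genDataOfRecord F N V ν M g K W s S j) Ψ (τ (c, z))) ∂(Measure.pi fun _ : ↥(Set.toFinite (B10Eq42TorusConstraint.bondsIn (j + 1) (s.Ω (j + 1))ᶜ)).toFinset => (HaarData.haar : Measure (SU N))) ≤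
      ∫⁻ y, ∫⁻ a, ŵ a * ENNReal.ofReal (Ψ (Function.update (Function.update (τ (c, avgRestrOfRecord F N K j (Set.toFinite (B10Eq42TorusConstraint.bondsIn j (s.Ω (j + 1))ᶜ)).toFinset (Set.toFinite (B10Eq42TorusConstraint.bondsIn (j + 1) (s.Ω (j + 1))ᶜ)).toFinset y)) j (Function.updateFinset ((τ (c, avgRestrOfRecord F N K j (Set.toFinite (B10Eq42TorusConstraint.bondsIn j (s.Ω (j + 1))ᶜ)).toFinset (Set.toFinite (B10Eq42TorusConstraint.bondsIn (j + 1) (s.Ω (j + 1))ᶜ)).toFinset y)) j).1 (Set.toFinite (B10Eq42TorusConstraint.bondsIn j (s.Ω (j + 1))ᶜ)).toFinset y, ((τ (c, avgRestrOfRecord F N K j (Set.toFinite (B10Eq42TorusConstraint.bondsIn j (s.Ω (j + 1))ᶜ)).toFinset (Set.toFinite (B10Eq42TorusConstraint.bondsIn (j + 1) (s.Ω (j + 1))ᶜ)).toFinset y)) j).2)) j (insA (Set.toFinite (B10Eq42TorusConstraint.bondsIn j ((s.Λ (j + 1))ᶜ ∩ s.Ω (j + 1)))).toFinset a ((Function.update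 (τ (c, avgRestrOfRecord F N K j (Set.toFinite (B10Eq42TorusConstraint.bondsIn j (s.Ω (j + 1))ᶜ)).toFinset (Set.toFinite (B10Eq42TorusConstraint.bondsIn (j + 1) (s.Ω (j + 1))ᶜ)).toFinset y)) j (Function.updateFinset ((τ (c, avgRestrOfRecord F N K j (Set.toFinite (B10Eq42TorusConstraint.bondsIn j (s.Ω (j + 1))ᶜ)).toFinset (Set.toFinite (B10Eq42TorusConstraint.bondsIn (j + 1) (s.Ω (j + 1))ᶜ)).toFinset y)) j).1 (Set.toFinite (B10Eq42TorusConstraint.bondsIn j (s.Ω (j + 1))ᶜ)).toFinset y, ((τ (c, avgRestrOfRecord F N K j (Set.toFinite (B10Eq42TorusConstraint.bondsIn j (s.Ω (j + 1))ᶜ)).toFinset (Set.toFinite (B10Eq42TorusConstraint.bondsIn (j + 1) (s.Ω (j + 1))ᶜ)).toFinset y)) j).2)) j))))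
          ∂(Measure.pi fun _ : ↥(Set.toFinite (B10Eq42TorusConstraint.bondsIn j ((s.Λ (j + 1))ᶜ ∩ s.Ω (j + 1)))).toFinset => (volume : Measure V))
        ∂(Measure.pi fun _ : ↥(Set.toFinite (B10Eq42TorusConstraint.bondsIn j (s.Ω (j + 1))ᶜ)).toFinset => (HaarData.haar : Measure (SU N))) := by
  have hmav : Measurable (avgRestrOfRecord F N K j (Set.toFinite (B10Eq42TorusConstraint.bondsIn j (s.Ω (j + 1))ᶜ)).toFinset (Set.toFinite (B10Eq42TorusConstraint.bondsIn (j + 1) (s.Ω (j + 1))ᶜ)).toFinset) := measurable_avgRestrOfRecord (F := F) (N := N) K j _ _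
  have hτ' : Measurable (fun p : (↥(Set.toFinite (B10Eq42TorusConstraint.bondsIn (j + 1) (s.Ω (j + 1))ᶜ)).toFinset → SU N) × (↥(Set.toFinite (B10Eq42TorusConstraint.bondsIn j (s.Ω (j + 1))ᶜ)).toFinset → SU N) => τ (c, p.1)) :=
    hτ.comp (measurable_const.prodMk measurable_fst)
  have hj : Measurable (fun p : (↥(Set.toFinite (B10Eq42TorusConstraint.bondsIn (j + 1) (s.Ω (j + 1))ᶜ)).toFinset → SU N) × (↥(Set.toFinite (B10Eq42TorusConstraint.bondsIn j (s.Ω (j + 1))ᶜ)).toFinset → SU N) => (τ (c, p.1)) j) := (measurable_pi_apply j).comp hτ'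
  have hω₁m : Measurable (fun p : (↥(Set.toFinite (B10Eq42TorusConstraint.bondsIn (j + 1) (s.Ω (j + 1))ᶜ)).toFinset → SU N) × (↥(Set.toFinite (B10Eq42TorusConstraint.bondsIn j (s.Ω (j + 1))ᶜ)).toFinset → SU N) =>
      Function.update (τ (c, p.1)) j (Function.updateFinset ((τ (c, p.1)) j).1 (Set.toFinite (B10Eq42TorusConstraint.bondsIn j (s.Ω (j + 1))ᶜ)).toFinset p.2, ((τ (c, p.1)) j).2)) :=
    measurable_update'.comp (hτ'.prodMk
      ((measurable_updateFinset'.comp ((measurable_fst.comp hj).prodMk measurable_snd)).prodMk (measurable_snd.comp hj)))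
  -- the integrand family of the V-factor: nonnegative and jointly measurable
  have hg0 : ∀ p : (↥(Set.toFinite (B10Eq42TorusConstraint.bondsIn (j + 1) (s.Ω (j + 1))ᶜ)).toFinset → SU N) × (↥(Set.toFinite (B10Eq42TorusConstraint.bondsIn j (s.Ω (j + 1))ᶜ)).toFinset → SU N),
      0 ≤ W.ζ j (s.Ω (j + 1))ᶜ (Function.update (τ (c, p.1)) j (Function.updateFinset ((τ (c, p.1)) j).1 (Set.toFinite (B10Eq42TorusConstraint.bondsIn j (s.Ω (j + 1))ᶜ)).toFinset p.2, ((τ (c, p.1)) j).2)) *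
        aOp j (Set.toFinite (B10Eq42TorusConstraint.bondsIn j ((s.Λ (j + 1))ᶜ ∩ s.Ω (j + 1)))).toFinset (W.w j (s.Λ (j + 1)) ((s.Λ (j + 1))ᶜ ∩ s.Ω (j + 1)) (S (j + 1))) Ψ
          (Function.update (τ (c, p.1)) j (Function.updateFinset ((τ (c, p.1)) j).1 (Set.toFinite (B10Eq42TorusConstraint.bondsIn j (s.Ω (j + 1))ᶜ)).toFinset p.2, ((τ (c, p.1)) j).2)) :=
    fun p => mul_nonneg (hζ0 _) (aOp_nonneg j _ hw0 hΨ0 _)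
  have hfm : Measurable (fun p : (↥(Set.toFinite (B10Eq42TorusConstraint.bondsIn (j + 1) (s.Ω (j + 1))ᶜ)).toFinset → SU N) × (↥(Set.toFinite (B10Eq42TorusConstraint.bondsIn j (s.Ω (j + 1))ᶜ)).toFinset → SU N) => ENNReal.ofReal
      (W.ζ j (s.Ω (j + 1))ᶜ (Function.update (τ (c, p.1)) j (Function.updateFinset ((τ (c, p.1)) j).1 (Set.toFinite (B10Eq42TorusConstraint.bondsIn j (s.Ω (j + 1))ᶜ)).toFinset p.2, ((τ (c, p.1)) j).2)) *
        aOp j (Set.toFinite (B10Eq42TorusConstraint.bondsIn j ((s.Λ (j + 1))ᶜ ∩ s.Ω (j + 1)))).toFinset (W.w j (s.Λ (j + 1)) ((s.Λ (j + 1))ᶜ ∩ s.Ω (j + 1)) (S (j + 1))) Ψ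
          (Function.update (τ (c, p.1)) j (Function.updateFinset ((τ (c, p.1)) j).1 (Set.toFinite (B10Eq42TorusConstraint.bondsIn j (s.Ω (j + 1))ᶜ)).toFinset p.2, ((τ (c, p.1)) j).2)))) :=
    ENNReal.measurable_ofReal.comp ((hζm.comp hω₁m).mul ((measurable_aOp j _ hwm hΨm).comp hω₁m))
  -- (1) generation `j` at the template IS the kernel transport of the `z`-slice read at `z`
  have hgen : ∀ z, genOp j (genDataOfRecord F N V ν M g K W s S j) Ψ (τ (c, z)) = kernelRT (avgRestrOfRecord F N K j (Set.toFinite (B10Eq42TorusConstraint.bondsIn j (s.Ω (j + 1))ᶜ)).toFinset (Set.toFinite (B10Eq42TorusConstraint.bondsIn (j + 1) (s.Ω (j + 1))ᶜ)).toFinset)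
      (fun y => W.ζ j (s.Ω (j + 1))ᶜ (Function.update (τ (c, z)) j (Function.updateFinset ((τ (c, z)) j).1 (Set.toFinite (B10Eq42TorusConstraint.bondsIn j (s.Ω (j + 1))ᶜ)).toFinset y, ((τ (c, z)) j).2)) *
        aOp j (Set.toFinite (B10Eq42TorusConstraint.bondsIn j ((s.Λ (j + 1))ᶜ ∩ s.Ω (j + 1)))).toFinset (W.w j (s.Λ (j + 1)) ((s.Λ (j + 1))ᶜ ∩ s.Ω (j + 1)) (S (j + 1))) Ψ
          (Function.update (τ (c, z)) j (Function.updateFinset ((τ (c, z)) j).1 (Set.toFinite (B10Eq42TorusConstraint.bondsIn j (s.Ω (j + 1))ᶜ)).toFinset y, ((τ (c, z)) j).2))) z := by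
    intro z
    rw [genOp_apply, vOp_apply]
    exact congrArg (fun w : ↥(Set.toFinite (B10Eq42TorusConstraint.bondsIn (j + 1) (s.Ω (j + 1))ᶜ)).toFinset → SU N => kernelRT (avgRestrOfRecord F N K j (Set.toFinite (B10Eq42TorusConstraint.bondsIn j (s.Ω (j + 1))ᶜ)).toFinset (Set.toFinite (B10Eq42TorusConstraint.bondsIn (j + 1) (s.Ω (j + 1))ᶜ)).toFinset)
      (fun y => W.ζ j (s.Ω (j + 1))ᶜ (Function.update (τ (c, z)) j (Function.updateFinset ((τ (c, z)) j).1 (Set.toFinite (B10Eq42TorusConstraint.bondsIn j (s.Ω (j + 1))ᶜ)).toFinset y, ((τ (c, z)) j).2)) *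
        aOp j (Set.toFinite (B10Eq42TorusConstraint.bondsIn j ((s.Λ (j + 1))ᶜ ∩ s.Ω (j + 1)))).toFinset (W.w j (s.Λ (j + 1)) ((s.Λ (j + 1))ᶜ ∩ s.Ω (j + 1)) (S (j + 1))) Ψ
          (Function.update (τ (c, z)) j (Function.updateFinset ((τ (c, z)) j).1 (Set.toFinite (B10Eq42TorusConstraint.bondsIn j (s.Ω (j + 1))ᶜ)).toFinset y, ((τ (c, z)) j).2))) w) (hτz c z)
  -- (2) the V-factor in `ℝ≥0∞` and the disintegration inequality
  have h1 : ∫⁻ z, ENNReal.ofReal (genOp j (genDataOfRecord F N V ν M g K W s S j) Ψ (τ (c, z))) ∂(Measure.pi fun _ : ↥(Set.toFinite (B10Eq42TorusConstraint.bondsIn (j + 1) (s.Ω (j + 1))ᶜ)).toFinset => (HaarData.haar : Measure (SU N))) ≤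
      ∫⁻ y, ENNReal.ofReal
        (W.ζ j (s.Ω (j + 1))ᶜ (Function.update (τ (c, avgRestrOfRecord F N K j (Set.toFinite (B10Eq42TorusConstraint.bondsIn j (s.Ω (j + 1))ᶜ)).toFinset (Set.toFinite (B10Eq42TorusConstraint.bondsIn (j + 1) (s.Ω (j + 1))ᶜ)).toFinset y)) j (Function.updateFinset ((τ (c, avgRestrOfRecord F N K j (Set.toFinite (B10Eq42TorusConstraint.bondsIn j (s.Ω (j + 1))ᶜ)).toFinset (Set.toFinite (B10Eq42TorusConstraint.bondsIn (j + 1) (s.Ω (j + 1))ᶜ)).toFinset y)) j).1 (Set.toFinite (B10Eq42TorusConstraint.bondsIn j (s.Ω (j + 1))ᶜ)).toFinset y, ((τ (c, avgRestrOfRecord F N K j (Set.toFinite (B10Eq42TorusConstraint.bondsIn j (s.Ω (j + 1))ᶜ)).toFinset (Set.toFinite (B10Eq42TorusConstraint.bondsIn (j + 1) (s.Ω (j + 1))ᶜ)).toFinset y)) j).2)) *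
          aOp j (Set.toFinite (B10Eq42TorusConstraint.bondsIn j ((s.Λ (j + 1))ᶜ ∩ s.Ω (j + 1)))).toFinset (W.w j (s.Λ (j + 1)) ((s.Λ (j + 1))ᶜ ∩ s.Ω (j + 1)) (S (j + 1))) Ψ (Function.update (τ (c, avgRestrOfRecord F N K j (Set.toFinite (B10Eq42TorusConstraint.bondsIn j (s.Ω (j + 1))ᶜ)).toFinset (Set.toFinite (B10Eq42TorusConstraint.bondsIn (j + 1) (s.Ω (j + 1))ᶜ)).toFinset y)) j (Function.updateFinset ((τ (c, avgRestrOfRecord F N K j (Set.toFinite (B10Eq42TorusConstraint.bondsIn j (s.Ω (j + 1))ᶜ)).toFinset (Set.toFinite (B10Eq42TorusConstraint.bondsIn (j + 1) (s.Ω (j + 1))ᶜ)).toFinset y)) j).1 (Set.toFinite (B10Eq42TorusConstraint.bondsIn j (s.Ω (j + 1))ᶜ)).toFinset y, ((τ (c, avgRestrOfRecord F N K j (Set.toFinite (B10Eq42TorusConstraint.bondsIn j (s.Ω (j + 1))ᶜ)).toFinset (Set.toFinite (B10Eq42TorusConstraint.bondsIn (j + 1) (s.Ω (j + 1))ᶜ)).toFinset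 y)) j).2)))
        ∂(Measure.pi fun _ : ↥(Set.toFinite (B10Eq42TorusConstraint.bondsIn j (s.Ω (j + 1))ᶜ)).toFinset => (HaarData.haar : Measure (SU N))) := by
    refine le_trans (lintegral_mono fun z => ?_)
      (lintegral_margDensity_condLaw_le _ _ hmav (f := fun p : (↥(Set.toFinite (B10Eq42TorusConstraint.bondsIn (j + 1) (s.Ω (j + 1))ᶜ)).toFinset → SU N) × (↥(Set.toFinite (B10Eq42TorusConstraint.bondsIn j (s.Ω (j + 1))ᶜ)).toFinset → SU N) => ENNReal.ofReal
        (W.ζ j (s.Ω (j + 1))ᶜ (Function.update (τ (c, p.1)) j (Function.updateFinset ((τ (c, p.1)) j).1 (Set.toFinite (B10Eq42TorusConstraint.bondsIn j (s.Ω (j + 1))ᶜ)).toFinset p.2, ((τ (c, p.1)) j).2)) *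
          aOp j (Set.toFinite (B10Eq42TorusConstraint.bondsIn j ((s.Λ (j + 1))ᶜ ∩ s.Ω (j + 1)))).toFinset (W.w j (s.Λ (j + 1)) ((s.Λ (j + 1))ᶜ ∩ s.Ω (j + 1)) (S (j + 1))) Ψ
            (Function.update (τ (c, p.1)) j (Function.updateFinset ((τ (c, p.1)) j).1 (Set.toFinite (B10Eq42TorusConstraint.bondsIn j (s.Ω (j + 1))ᶜ)).toFinset p.2, ((τ (c, p.1)) j).2)))) hfm)
    rw [hgen z]
    exact ofReal_kernelRT_le _ (fun y => hg0 (z, y)) z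
  -- (3) the ζ·A-factor under fibre domination, pointwise in `y`
  refine h1.trans (lintegral_mono fun y => ?_)
  exact ofReal_zeta_mul_aOp_le j _ hw0 hΨ0 ŵ hdom _ (hζ1 _)

end Generation

/-! ## §3  Nesting of the bond sets along (2.1), measurability and positivity of the branches -/

section Nesting

variable {F : T4Family} {N : ℕ} [NeZero N] {V : Type} [NormedAddCommGroup V] [InnerProductSpace ℝ V] [FiniteDimensional ℝ V]
  [MeasurableSpace V] [BorelSpace V]
variable (ν : Stage7Numerics) (M : ℕ) (g : ℕ → ℝ) (K : ℕ) (W : TkWeights F N V K)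

omit [NeZero N] [NormedAddCommGroup V] [InnerProductSpace ℝ V] [FiniteDimensional ℝ V] [MeasurableSpace V] [BorelSpace V] in
/-- **(2.1) NESTING `Ω_{i+2} ⊆ Ω_{i+1}`** for a sequence of record (inside the window by `Chain21.Ω_succ_subset_Ω`, off it `Ω = ∅`). [cite: Balaban1988Convergent, (2.1) p.254] -/
theorem seqOfRecord_Ω_succ_succ_subset {n : ℕ} (s : SeqOfRecord F ν M g K n) (i : ℕ) : s.Ω (i + 2) ⊆ s.Ω (i + 1) := by
  by_cases h : i + 2 ≤ n
  · exact s.chain.Ω_succ_subset_Ω (j := i + 1) (by omega) (by omega)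
  · rw [s.Ω_off (i + 2) (fun h' => h h'.2)]
    exact Set.empty_subset _

omit [NormedAddCommGroup V] [InnerProductSpace ℝ V] [FiniteDimensional ℝ V] [MeasurableSpace V] [BorelSpace V] in
/-- **THE VARIABLES GENERATION `i` PRODUCES ARE INTEGRATED BY GENERATION `i+1`**: the level-`(i+1)` bonds outside `Ω_{i+1}` are among the level-`(i+1)` bonds outside
`Ω_{i+2}` — `sV′_i ⊆ sV_{i+1}` for 11a's data of record. [cite: Balaban1988Convergent, (2.1) p.254, (2.21) p.258] -/
theorem sV'_subset_sV_succ {n : ℕ} (s : SeqOfRecord F ν M g K n) (S : ℕ → Set (Site (F.P K) 0)) (i : ℕ)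
    {h₁ : DecidableEq (PBond (F.P K) i)} {h₂ : DecidableEq (PBond (F.P K) (i + 1))} :
    (genDataOfRecord F N V ν M g K W s S i).sV' ⊆ (genDataOfRecord F N V ν M g K W s S (i + 1)).sV := by
  intro b hb
  simp only [genDataOfRecord, Set.Finite.mem_toFinset] at hb ⊢
  exact B10Eq42TorusConstraint.bondsIn_mono (Set.compl_subset_compl.mpr (seqOfRecord_Ω_succ_succ_subset ν M g K s i)) hb

/-- The branch operator applied to a measurable operand is a measurable function on the multiscale configuration space, for weights measurable at the regions the
generations read (C1's `measurable_tkOp`). [cite: Balaban1988Convergent, (2.20)–(2.21) p.258 (bookkeeping)] -/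
theorem measurable_tkBranchOfRecord {n : ℕ} (s : SeqOfRecord F ν M g K n) (S : ℕ → Set (Site (F.P K) 0))
    (hζm : ∀ j, Measurable (W.ζ j (s.Ω (j + 1))ᶜ)) (hwm : ∀ j, Measurable (W.w j (s.Λ (j + 1)) ((s.Λ (j + 1))ᶜ ∩ s.Ω (j + 1)) (S (j + 1))))
    {Φ : MultiCfg (F.P K) (SU N) V → ℝ} (hΦm : Measurable Φ) (i : ℕ) : Measurable (tkBranchOfRecord F N V ν M g K W s S i Φ) := by
  unfold tkBranchOfRecord
  exact measurable_tkOp _ (fun j Ψ hΨ => measurable_genOp_genDataOfRecord F N V ν M g K W s S j (hζm j) (hwm j) hΨ) i hΦm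

/-- The branch operator preserves nonnegativity under `0 ≤ ζ_j`, `0 ≤ w_j` at the regions read (11a's `tkOp_nonneg`, `genOp_nonneg`; transport positivity PROVED).
[cite: Balaban1988Convergent, (2.20)–(2.21) p.258 (bookkeeping)] -/
theorem tkBranchOfRecord_nonneg' {n : ℕ} (s : SeqOfRecord F ν M g K n) (S : ℕ → Set (Site (F.P K) 0))
    (hζ0 : ∀ j ω, 0 ≤ W.ζ j (s.Ω (j + 1))ᶜ ω) (hw0 : ∀ j ω, 0 ≤ W.w j (s.Λ (j + 1)) ((s.Λ (j + 1))ᶜ ∩ s.Ω (j + 1)) (S (j + 1)) ω)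
    {Φ : MultiCfg (F.P K) (SU N) V → ℝ} (hΦ0 : ∀ ω, 0 ≤ Φ ω) (i : ℕ) (ω : MultiCfg (F.P K) (SU N) V) :
    0 ≤ tkBranchOfRecord F N V ν M g K W s S i Φ ω := by
  have hgen : ∀ (j : ℕ) {hdec : DecidableEq (PBond (F.P K) j)} (Ψ : MultiCfg (F.P K) (SU N) V → ℝ), (∀ ω, 0 ≤ Ψ ω) →
      ∀ ω, 0 ≤ genOp j (genDataOfRecord F N V ν M g K W s S j) Ψ ω := fun j _ Ψ hΨ =>
    genOp_nonneg j ⟨kernelRTOfRecord_posPres F N K j _ _, fun ω => hζ0 j ω, fun ω => hw0 j ω⟩ hΨ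
  unfold tkBranchOfRecord
  exact tkOp_nonneg _ (fun j Ψ hΨ => hgen j Ψ hΨ) i hΦ0 ω

end Nesting


/-! ## §4  ★ The mass bound through the generations, by induction over TEMPLATES -/

section Induction

variable {F : T4Family} {N : ℕ} [NeZero N] {V : Type} [NormedAddCommGroup V] [InnerProductSpace ℝ V] [FiniteDimensional ℝ V]
  [MeasurableSpace V] [BorelSpace V]
variable (ν : Stage7Numerics) (M : ℕ) (g : ℕ → ℝ) (K : ℕ) (W : TkWeights F N V K)

/-- **★★ THE MASS BOUND THROUGH 11a's GENERATIONS.**  Weights: `ζ_j` measurable with `0 ≤ ζ_j ≤ 1`, `w_j` measurable, `0 ≤ w_j`, dominated on every configuration by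
`ŵ_j(A_j|_{sA_j})` with `∫⁻ ŵ_j ≤ Cw j`; operand `Φ` measurable with `0 ≤ Φ ≤ CΦ`.  Then for every generation count `i+1`, every measurable space of parameters
`Γ` and every measurable TEMPLATE `τ : Γ × (V_{i+1}|_{sV′_i}) → configurations` that puts its second argument at the level-`(i+1)` bonds of `sV′_i` (the level-`(i+1)`
bonds outside `Ω_{i+1}`): `∫⁻ dHaar(z) ofReal(𝐓_{i+1}(s,S)[Φ](τ(c,z))) ≤ ofReal CΦ · ∏_{j ≤ i} Cw j`.  (The bond finsets are written out — they are 11a's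
`(genDataOfRecord …).sV′ ∕ .sA` — so that the statement does not fix a `DecidableEq` instance.)  Induction: §2's one-generation inequality, Tonelli over the A-fibre, the
splitting `Haar^{sV_{i+1}} = Haar^{sV′_i} ⊗ Haar^{rest}` along §3's nesting, and the hypothesis at the template one generation down.
[cite: Balaban1988Convergent, (2.20)–(2.21) p.258, (2.1) p.254, (3.23)–(3.24) p.270; Balaban1985Averaging, (10) p.19] -/
theorem lintegral_tkBranchOfRecord_template_le {n : ℕ} (s : SeqOfRecord F ν M g K n) (S : ℕ → Set (Site (F.P K) 0))
    (hζm : ∀ j, Measurable (W.ζ j (s.Ω (j + 1))ᶜ)) (hζ0 : ∀ j ω, 0 ≤ W.ζ j (s.Ω (j + 1))ᶜ ω) (hζ1 : ∀ j ω, W.ζ j (s.Ω (j + 1))ᶜ ω ≤ 1)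
    (hwm : ∀ j, Measurable (W.w j (s.Λ (j + 1)) ((s.Λ (j + 1))ᶜ ∩ s.Ω (j + 1)) (S (j + 1))))
    (hw0 : ∀ j ω, 0 ≤ W.w j (s.Λ (j + 1)) ((s.Λ (j + 1))ᶜ ∩ s.Ω (j + 1)) (S (j + 1)) ω)
    (ŵ : (j : ℕ) → (↥(Set.toFinite (B10Eq42TorusConstraint.bondsIn j ((s.Λ (j + 1))ᶜ ∩ s.Ω (j + 1)))).toFinset → V) → ℝ≥0∞) (hŵm : ∀ j, Measurable (ŵ j))
    (hdom : ∀ j ω, ENNReal.ofReal (W.w j (s.Λ (j + 1)) ((s.Λ (j + 1))ᶜ ∩ s.Ω (j + 1)) (S (j + 1)) ω) ≤ ŵ j (fun b : ↥(Set.toFinite (B10Eq42TorusConstraint.bondsIn j ((s.Λ (j + 1))ᶜ ∩ s.Ω (j + 1)))).toFinset => (ω j).2 b))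
    (Cw : ℕ → ℝ≥0∞) (hCw : ∀ j, ∫⁻ a, ŵ j a ∂(Measure.pi fun _ : ↥(Set.toFinite (B10Eq42TorusConstraint.bondsIn j ((s.Λ (j + 1))ᶜ ∩ s.Ω (j + 1)))).toFinset => (volume : Measure V)) ≤ Cw j)
    {Φ : MultiCfg (F.P K) (SU N) V → ℝ} (hΦm : Measurable Φ) (hΦ0 : ∀ ω, 0 ≤ Φ ω) (CΦ : ℝ) (hΦle : ∀ ω, Φ ω ≤ CΦ) :
    ∀ (i : ℕ) (Γ : Type) [MeasurableSpace Γ] (τ : Γ × (↥(Set.toFinite (B10Eq42TorusConstraint.bondsIn (i + 1) (s.Ω (i + 1))ᶜ)).toFinset → SU N) → MultiCfg (F.P K) (SU N) V), Measurable τ →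
      (∀ c z, (fun b : ↥(Set.toFinite (B10Eq42TorusConstraint.bondsIn (i + 1) (s.Ω (i + 1))ᶜ)).toFinset => ((τ (c, z)) (i + 1)).1 b) = z) → ∀ c : Γ,
      ∫⁻ z, ENNReal.ofReal (tkBranchOfRecord F N V ν M g K W s S (i + 1) Φ (τ (c, z))) ∂(Measure.pi fun _ : ↥(Set.toFinite (B10Eq42TorusConstraint.bondsIn (i + 1) (s.Ω (i + 1))ᶜ)).toFinset => (HaarData.haar : Measure (SU N))) ≤
        ENNReal.ofReal CΦ * ∏ j ∈ Finset.range (i + 1), Cw j := by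
  haveI : IsProbabilityMeasure (HaarData.haar : Measure (SU N)) := HaarData.isProb
  have hBm : ∀ i, Measurable (tkBranchOfRecord F N V ν M g K W s S i Φ) := measurable_tkBranchOfRecord ν M g K W s S hζm hwm hΦm
  have hB0 : ∀ i ω, 0 ≤ tkBranchOfRecord F N V ν M g K W s S i Φ ω := tkBranchOfRecord_nonneg' ν M g K W s S hζ0 hw0 hΦ0
  intro i
  induction i with
  | zero =>
      intro Γ _ τ hτ hτz c
      -- generation 0 applied to `Φ` itself: §2, then `Φ ≤ CΦ` and `∫⁻ ŵ₀ ≤ Cw 0`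
      have hstep := lintegral_genOp_genDataOfRecord_le ν M g K W s S 0 (hdec := fun a b => Classical.propDecidable (a = b))
        (hζm 0) (hζ0 0) (hζ1 0) (hwm 0) (hw0 0) (ŵ 0) (hdom 0) hΦm hΦ0 τ hτ hτz c
      rw [tkBranchOfRecord_succ, tkBranchOfRecord_zero]
      refine hstep.trans ?_
      rw [Finset.prod_range_succ, Finset.prod_range_zero, one_mul]
      calc _ ≤ ∫⁻ _y, ∫⁻ a, ŵ 0 a * ENNReal.ofReal CΦ ∂(Measure.pi fun _ : ↥(Set.toFinite (B10Eq42TorusConstraint.bondsIn 0 ((s.Λ (0 + 1))ᶜ ∩ s.Ω (0 + 1)))).toFinset => (volume : Measure V))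
            ∂(Measure.pi fun _ : ↥(Set.toFinite (B10Eq42TorusConstraint.bondsIn 0 (s.Ω (0 + 1))ᶜ)).toFinset => (HaarData.haar : Measure (SU N))) :=
            lintegral_mono fun y => lintegral_mono fun a => mul_le_mul' le_rfl (ENNReal.ofReal_le_ofReal (hΦle _))
        _ = (∫⁻ a, ŵ 0 a ∂(Measure.pi fun _ : ↥(Set.toFinite (B10Eq42TorusConstraint.bondsIn 0 ((s.Λ (0 + 1))ᶜ ∩ s.Ω (0 + 1)))).toFinset => (volume : Measure V))) * ENNReal.ofReal CΦ := by
            rw [lintegral_mul_const _ (hŵm 0), lintegral_const, measure_univ, mul_one]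
        _ ≤ Cw 0 * ENNReal.ofReal CΦ := mul_le_mul' (hCw 0) le_rfl
        _ = ENNReal.ofReal CΦ * Cw 0 := mul_comm _ _
  | succ i ih =>
      intro Γ _ τ hτ hτz c
      -- 11a's generations carry the CLASSICAL `DecidableEq` on bonds: pin it as the local instance so that every term below matches them syntactically
      letI hdecA : DecidableEq (PBond (F.P K) (i + 1)) := fun a b => Classical.propDecidable (a = b)
      -- nesting: the produced bonds of generation `i` are among the integrated bonds of generation `i+1`
      have hsub : (Set.toFinite (B10Eq42TorusConstraint.bondsIn (i + 1) (s.Ω (i + 1))ᶜ)).toFinset ⊆ (Set.toFinite (B10Eq42TorusConstraint.bondsIn (i + 1) (s.Ω ((i + 1) + 1))ᶜ)).toFinset := by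
        intro b hb
        rw [Set.Finite.mem_toFinset] at hb ⊢
        exact B10Eq42TorusConstraint.bondsIn_mono (Set.compl_subset_compl.mpr (seqOfRecord_Ω_succ_succ_subset ν M g K s i)) hb
      have hmav : Measurable (avgRestrOfRecord F N K (i + 1) (Set.toFinite (B10Eq42TorusConstraint.bondsIn (i + 1) (s.Ω ((i + 1) + 1))ᶜ)).toFinset (Set.toFinite (B10Eq42TorusConstraint.bondsIn ((i + 1) + 1) (s.Ω ((i + 1) + 1))ᶜ)).toFinset) := measurable_avgRestrOfRecord (F := F) (N := N) K (i + 1) _ _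
      -- the configuration after generation `i+1`'s two insertions: a jointly measurable function of (parameter, gauge variables on `sV`, fluctuation variables on `sA`)
      have hΩ₂m : Measurable (fun q : Γ × (↥(Set.toFinite (B10Eq42TorusConstraint.bondsIn (i + 1) (s.Ω ((i + 1) + 1))ᶜ)).toFinset → SU N) × (↥(Set.toFinite (B10Eq42TorusConstraint.bondsIn (i + 1) ((s.Λ ((i + 1) + 1))ᶜ ∩ s.Ω ((i + 1) + 1)))).toFinset → V) => (Function.update (Function.update (τ (q.1, avgRestrOfRecord F N K (i + 1) (Set.toFinite (B10Eq42TorusConstraint.bondsIn (i + 1) (s.Ω ((i + 1) + 1))ᶜ)).toFinset (Set.toFinite (B10Eq42TorusConstraint.bondsIn ((i + 1) + 1) (s.Ω ((i + 1) + 1))ᶜ)).toFinset q.2.1)) (i + 1) (Function.updateFinset ((τ (q.1, avgRestrOfRecord F N K (i + 1) (Set.toFinite (B10Eq42TorusConstraint.bondsIn (i + 1) (s.Ω ((i + 1) + 1))ᶜ)).toFinset (Set.toFinite (B10Eq42TorusConstraint.bondsIn ((i + 1) + 1) (s.Ω ((i + 1) + 1))ᶜ)).toFinset q.2.1)) (i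 + 1)).1 (Set.toFinite (B10Eq42TorusConstraint.bondsIn (i + 1) (s.Ω ((i + 1) + 1))ᶜ)).toFinset q.2.1, ((τ (q.1, avgRestrOfRecord F N K (i + 1) (Set.toFinite (B10Eq42TorusConstraint.bondsIn (i + 1) (s.Ω ((i + 1) + 1))ᶜ)).toFinset (Set.toFinite (B10Eq42TorusConstraint.bondsIn ((i + 1) + 1) (s.Ω ((i + 1) + 1))ᶜ)).toFinset q.2.1)) (i + 1)).2)) (i + 1) (insA (Set.toFinite (B10Eq42TorusConstraint.bondsIn (i + 1) ((s.Λ ((i + 1) + 1))ᶜ ∩ s.Ω ((i + 1) + 1)))).toFinset q.2.2 ((Function.update (τ (q.1, avgRestrOfRecord F N K (i + 1) (Set.toFinite (B10Eq42TorusConstraint.bondsIn (i + 1) (s.Ω ((i + 1) + 1))ᶜ)).toFinset (Set.toFinite (B10Eq42TorusConstraint.bondsIn ((i + 1) + 1) (s.Ω ((i + 1) + 1))ᶜ)).toFinset q.2.1)) (i + 1) (Function.updateFinset ((τ (q.1, avgRestrOfRecord F N K (i + 1) (Set.toFinite (B10Eq42TorusConstraint.bondsIn (i + 1) (s.Ω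 ((i + 1) + 1))ᶜ)).toFinset (Set.toFinite (B10Eq42TorusConstraint.bondsIn ((i + 1) + 1) (s.Ω ((i + 1) + 1))ᶜ)).toFinset q.2.1)) (i + 1)).1 (Set.toFinite (B10Eq42TorusConstraint.bondsIn (i + 1) (s.Ω ((i + 1) + 1))ᶜ)).toFinset q.2.1, ((τ (q.1, avgRestrOfRecord F N K (i + 1) (Set.toFinite (B10Eq42TorusConstraint.bondsIn (i + 1) (s.Ω ((i + 1) + 1))ᶜ)).toFinset (Set.toFinite (B10Eq42TorusConstraint.bondsIn ((i + 1) + 1) (s.Ω ((i + 1) + 1))ᶜ)).toFinset q.2.1)) (i + 1)).2)) (i + 1))))) := by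
        have hy : Measurable (fun q : Γ × (↥(Set.toFinite (B10Eq42TorusConstraint.bondsIn (i + 1) (s.Ω ((i + 1) + 1))ᶜ)).toFinset → SU N) × (↥(Set.toFinite (B10Eq42TorusConstraint.bondsIn (i + 1) ((s.Λ ((i + 1) + 1))ᶜ ∩ s.Ω ((i + 1) + 1)))).toFinset → V) => q.2.1) := measurable_fst.comp measurable_snd
        have ha : Measurable (fun q : Γ × (↥(Set.toFinite (B10Eq42TorusConstraint.bondsIn (i + 1) (s.Ω ((i + 1) + 1))ᶜ)).toFinset → SU N) × (↥(Set.toFinite (B10Eq42TorusConstraint.bondsIn (i + 1) ((s.Λ ((i + 1) + 1))ᶜ ∩ s.Ω ((i + 1) + 1)))).toFinset → V) => q.2.2) := measurable_snd.comp measurable_snd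
        have hτc : Measurable (fun q : Γ × (↥(Set.toFinite (B10Eq42TorusConstraint.bondsIn (i + 1) (s.Ω ((i + 1) + 1))ᶜ)).toFinset → SU N) × (↥(Set.toFinite (B10Eq42TorusConstraint.bondsIn (i + 1) ((s.Λ ((i + 1) + 1))ᶜ ∩ s.Ω ((i + 1) + 1)))).toFinset → V) => τ (q.1, avgRestrOfRecord F N K (i + 1) (Set.toFinite (B10Eq42TorusConstraint.bondsIn (i + 1) (s.Ω ((i + 1) + 1))ᶜ)).toFinset (Set.toFinite (B10Eq42TorusConstraint.bondsIn ((i + 1) + 1) (s.Ω ((i + 1) + 1))ᶜ)).toFinset q.2.1)) := hτ.comp (measurable_fst.prodMk (hmav.comp hy))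
        have hτj : Measurable (fun q : Γ × (↥(Set.toFinite (B10Eq42TorusConstraint.bondsIn (i + 1) (s.Ω ((i + 1) + 1))ᶜ)).toFinset → SU N) × (↥(Set.toFinite (B10Eq42TorusConstraint.bondsIn (i + 1) ((s.Λ ((i + 1) + 1))ᶜ ∩ s.Ω ((i + 1) + 1)))).toFinset → V) => (τ (q.1, avgRestrOfRecord F N K (i + 1) (Set.toFinite (B10Eq42TorusConstraint.bondsIn (i + 1) (s.Ω ((i + 1) + 1))ᶜ)).toFinset (Set.toFinite (B10Eq42TorusConstraint.bondsIn ((i + 1) + 1) (s.Ω ((i + 1) + 1))ᶜ)).toFinset q.2.1)) (i + 1)) := (measurable_pi_apply (i + 1)).comp hτc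
        have hω₁ : Measurable (fun q : Γ × (↥(Set.toFinite (B10Eq42TorusConstraint.bondsIn (i + 1) (s.Ω ((i + 1) + 1))ᶜ)).toFinset → SU N) × (↥(Set.toFinite (B10Eq42TorusConstraint.bondsIn (i + 1) ((s.Λ ((i + 1) + 1))ᶜ ∩ s.Ω ((i + 1) + 1)))).toFinset → V) => (Function.update (τ (q.1, avgRestrOfRecord F N K (i + 1) (Set.toFinite (B10Eq42TorusConstraint.bondsIn (i + 1) (s.Ω ((i + 1) + 1))ᶜ)).toFinset (Set.toFinite (B10Eq42TorusConstraint.bondsIn ((i + 1) + 1) (s.Ω ((i + 1) + 1))ᶜ)).toFinset q.2.1)) (i + 1) (Function.updateFinset ((τ (q.1, avgRestrOfRecord F N K (i + 1) (Set.toFinite (B10Eq42TorusConstraint.bondsIn (i + 1) (s.Ω ((i + 1) + 1))ᶜ)).toFinset (Set.toFinite (B10Eq42TorusConstraint.bondsIn ((i + 1) + 1) (s.Ω ((i + 1) + 1))ᶜ)).toFinset q.2.1)) (i + 1)).1 (Set.toFinite (B10Eq42TorusConstraint.bondsIn (i + 1) (s.Ω ((i + 1) + 1))ᶜ)).toFinset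 q.2.1, ((τ (q.1, avgRestrOfRecord F N K (i + 1) (Set.toFinite (B10Eq42TorusConstraint.bondsIn (i + 1) (s.Ω ((i + 1) + 1))ᶜ)).toFinset (Set.toFinite (B10Eq42TorusConstraint.bondsIn ((i + 1) + 1) (s.Ω ((i + 1) + 1))ᶜ)).toFinset q.2.1)) (i + 1)).2))) :=
          measurable_update'.comp (hτc.prodMk ((measurable_updateFinset'.comp ((measurable_fst.comp hτj).prodMk hy)).prodMk (measurable_snd.comp hτj)))
        have hω₁j : Measurable (fun q : Γ × (↥(Set.toFinite (B10Eq42TorusConstraint.bondsIn (i + 1) (s.Ω ((i + 1) + 1))ᶜ)).toFinset → SU N) × (↥(Set.toFinite (B10Eq42TorusConstraint.bondsIn (i + 1) ((s.Λ ((i + 1) + 1))ᶜ ∩ s.Ω ((i + 1) + 1)))).toFinset → V) => (Function.update (τ (q.1, avgRestrOfRecord F N K (i + 1) (Set.toFinite (B10Eq42TorusConstraint.bondsIn (i + 1) (s.Ω ((i + 1) + 1))ᶜ)).toFinset (Set.toFinite (B10Eq42TorusConstraint.bondsIn ((i + 1) + 1) (s.Ω ((i + 1) + 1))ᶜ)).toFinset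 q.2.1)) (i + 1) (Function.updateFinset ((τ (q.1, avgRestrOfRecord F N K (i + 1) (Set.toFinite (B10Eq42TorusConstraint.bondsIn (i + 1) (s.Ω ((i + 1) + 1))ᶜ)).toFinset (Set.toFinite (B10Eq42TorusConstraint.bondsIn ((i + 1) + 1) (s.Ω ((i + 1) + 1))ᶜ)).toFinset q.2.1)) (i + 1)).1 (Set.toFinite (B10Eq42TorusConstraint.bondsIn (i + 1) (s.Ω ((i + 1) + 1))ᶜ)).toFinset q.2.1, ((τ (q.1, avgRestrOfRecord F N K (i + 1) (Set.toFinite (B10Eq42TorusConstraint.bondsIn (i + 1) (s.Ω ((i + 1) + 1))ᶜ)).toFinset (Set.toFinite (B10Eq42TorusConstraint.bondsIn ((i + 1) + 1) (s.Ω ((i + 1) + 1))ᶜ)).toFinset q.2.1)) (i + 1)).2)) (i + 1)) := (measurable_pi_apply (i + 1)).comp hω₁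
        exact measurable_update'.comp (hω₁.prodMk ((measurable_fst.comp hω₁j).prodMk (measurable_updateFinset'.comp ((measurable_snd.comp hω₁j).prodMk ha))))
      -- the TEMPLATE ONE GENERATION DOWN: parameter `(c, a, r)`, variables `z` on `sV′_i` glued with `r` into the integrated gauge variables of generation `i+1`
      have hτ'm : Measurable (fun q : (Γ × ((↥(Set.toFinite (B10Eq42TorusConstraint.bondsIn (i + 1) ((s.Λ ((i + 1) + 1))ᶜ ∩ s.Ω ((i + 1) + 1)))).toFinset → V) × ({b : ↥(Set.toFinite (B10Eq42TorusConstraint.bondsIn (i + 1) (s.Ω ((i + 1) + 1))ᶜ)).toFinset // (b : PBond (F.P K) (i + 1)) ∉ (Set.toFinite (B10Eq42TorusConstraint.bondsIn (i + 1) (s.Ω (i + 1))ᶜ)).toFinset} → SU N))) × (↥(Set.toFinite (B10Eq42TorusConstraint.bondsIn (i + 1) (s.Ω (i + 1))ᶜ)).toFinset → SU N) => (Function.update (Function.update (τ (q.1.1, avgRestrOfRecord F N K (i + 1) (Set.toFinite (B10Eq42TorusConstraint.bondsIn (i + 1) (s.Ω ((i + 1) + 1))ᶜ)).toFinset (Set.toFinite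 (B10Eq42TorusConstraint.bondsIn ((i + 1) + 1) (s.Ω ((i + 1) + 1))ᶜ)).toFinset (splitGlue (Set.toFinite (B10Eq42TorusConstraint.bondsIn (i + 1) (s.Ω ((i + 1) + 1))ᶜ)).toFinset (Set.toFinite (B10Eq42TorusConstraint.bondsIn (i + 1) (s.Ω (i + 1))ᶜ)).toFinset q.2 q.1.2.2))) (i + 1) (Function.updateFinset ((τ (q.1.1, avgRestrOfRecord F N K (i + 1) (Set.toFinite (B10Eq42TorusConstraint.bondsIn (i + 1) (s.Ω ((i + 1) + 1))ᶜ)).toFinset (Set.toFinite (B10Eq42TorusConstraint.bondsIn ((i + 1) + 1) (s.Ω ((i + 1) + 1))ᶜ)).toFinset (splitGlue (Set.toFinite (B10Eq42TorusConstraint.bondsIn (i + 1) (s.Ω ((i + 1) + 1))ᶜ)).toFinset (Set.toFinite (B10Eq42TorusConstraint.bondsIn (i + 1) (s.Ω (i + 1))ᶜ)).toFinset q.2 q.1.2.2))) (i + 1)).1 (Set.toFinite (B10Eq42TorusConstraint.bondsIn (i + 1) (s.Ω ((i + 1) + 1))ᶜ)).toFinset (splitGlue (Set.toFinite (B10Eq42TorusConstraint.bondsIn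 (i + 1) (s.Ω ((i + 1) + 1))ᶜ)).toFinset (Set.toFinite (B10Eq42TorusConstraint.bondsIn (i + 1) (s.Ω (i + 1))ᶜ)).toFinset q.2 q.1.2.2), ((τ (q.1.1, avgRestrOfRecord F N K (i + 1) (Set.toFinite (B10Eq42TorusConstraint.bondsIn (i + 1) (s.Ω ((i + 1) + 1))ᶜ)).toFinset (Set.toFinite (B10Eq42TorusConstraint.bondsIn ((i + 1) + 1) (s.Ω ((i + 1) + 1))ᶜ)).toFinset (splitGlue (Set.toFinite (B10Eq42TorusConstraint.bondsIn (i + 1) (s.Ω ((i + 1) + 1))ᶜ)).toFinset (Set.toFinite (B10Eq42TorusConstraint.bondsIn (i + 1) (s.Ω (i + 1))ᶜ)).toFinset q.2 q.1.2.2))) (i + 1)).2)) (i + 1) (insA (Set.toFinite (B10Eq42TorusConstraint.bondsIn (i + 1) ((s.Λ ((i + 1) + 1))ᶜ ∩ s.Ω ((i + 1) + 1)))).toFinset q.1.2.1 ((Function.update (τ (q.1.1, avgRestrOfRecord F N K (i + 1) (Set.toFinite (B10Eq42TorusConstraint.bondsIn (i + 1) (s.Ω ((i + 1) + 1))ᶜ)).toFinset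 (Set.toFinite (B10Eq42TorusConstraint.bondsIn ((i + 1) + 1) (s.Ω ((i + 1) + 1))ᶜ)).toFinset (splitGlue (Set.toFinite (B10Eq42TorusConstraint.bondsIn (i + 1) (s.Ω ((i + 1) + 1))ᶜ)).toFinset (Set.toFinite (B10Eq42TorusConstraint.bondsIn (i + 1) (s.Ω (i + 1))ᶜ)).toFinset q.2 q.1.2.2))) (i + 1) (Function.updateFinset ((τ (q.1.1, avgRestrOfRecord F N K (i + 1) (Set.toFinite (B10Eq42TorusConstraint.bondsIn (i + 1) (s.Ω ((i + 1) + 1))ᶜ)).toFinset (Set.toFinite (B10Eq42TorusConstraint.bondsIn ((i + 1) + 1) (s.Ω ((i + 1) + 1))ᶜ)).toFinset (splitGlue (Set.toFinite (B10Eq42TorusConstraint.bondsIn (i + 1) (s.Ω ((i + 1) + 1))ᶜ)).toFinset (Set.toFinite (B10Eq42TorusConstraint.bondsIn (i + 1) (s.Ω (i + 1))ᶜ)).toFinset q.2 q.1.2.2))) (i + 1)).1 (Set.toFinite (B10Eq42TorusConstraint.bondsIn (i + 1) (s.Ω ((i + 1) + 1))ᶜ)).toFinset (splitGlue (Set.toFinite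 (B10Eq42TorusConstraint.bondsIn (i + 1) (s.Ω ((i + 1) + 1))ᶜ)).toFinset (Set.toFinite (B10Eq42TorusConstraint.bondsIn (i + 1) (s.Ω (i + 1))ᶜ)).toFinset q.2 q.1.2.2), ((τ (q.1.1, avgRestrOfRecord F N K (i + 1) (Set.toFinite (B10Eq42TorusConstraint.bondsIn (i + 1) (s.Ω ((i + 1) + 1))ᶜ)).toFinset (Set.toFinite (B10Eq42TorusConstraint.bondsIn ((i + 1) + 1) (s.Ω ((i + 1) + 1))ᶜ)).toFinset (splitGlue (Set.toFinite (B10Eq42TorusConstraint.bondsIn (i + 1) (s.Ω ((i + 1) + 1))ᶜ)).toFinset (Set.toFinite (B10Eq42TorusConstraint.bondsIn (i + 1) (s.Ω (i + 1))ᶜ)).toFinset q.2 q.1.2.2))) (i + 1)).2)) (i + 1))))) :=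
        hΩ₂m.comp ((measurable_fst.comp measurable_fst).prodMk
          (((measurable_splitGlue (Set.toFinite (B10Eq42TorusConstraint.bondsIn (i + 1) (s.Ω ((i + 1) + 1))ᶜ)).toFinset (Set.toFinite (B10Eq42TorusConstraint.bondsIn (i + 1) (s.Ω (i + 1))ᶜ)).toFinset).comp (measurable_snd.prodMk (measurable_snd.comp (measurable_snd.comp measurable_fst)))).prodMk
            (measurable_fst.comp (measurable_snd.comp measurable_fst))))
      have hτ'z : ∀ (c' : Γ × ((↥(Set.toFinite (B10Eq42TorusConstraint.bondsIn (i + 1) ((s.Λ ((i + 1) + 1))ᶜ ∩ s.Ω ((i + 1) + 1)))).toFinset → V) × ({b : ↥(Set.toFinite (B10Eq42TorusConstraint.bondsIn (i + 1) (s.Ω ((i + 1) + 1))ᶜ)).toFinset // (b : PBond (F.P K) (i + 1)) ∉ (Set.toFinite (B10Eq42TorusConstraint.bondsIn (i + 1) (s.Ω (i + 1))ᶜ)).toFinset} → SU N))) (z : (↥(Set.toFinite (B10Eq42TorusConstraint.bondsIn (i + 1) (s.Ω (i + 1))ᶜ)).toFinset → SU N)),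
          (fun b : ↥(Set.toFinite (B10Eq42TorusConstraint.bondsIn (i + 1) (s.Ω (i + 1))ᶜ)).toFinset => (((Function.update (Function.update (τ (c'.1, avgRestrOfRecord F N K (i + 1) (Set.toFinite (B10Eq42TorusConstraint.bondsIn (i + 1) (s.Ω ((i + 1) + 1))ᶜ)).toFinset (Set.toFinite (B10Eq42TorusConstraint.bondsIn ((i + 1) + 1) (s.Ω ((i + 1) + 1))ᶜ)).toFinset (splitGlue (Set.toFinite (B10Eq42TorusConstraint.bondsIn (i + 1) (s.Ω ((i + 1) + 1))ᶜ)).toFinset (Set.toFinite (B10Eq42TorusConstraint.bondsIn (i + 1) (s.Ω (i + 1))ᶜ)).toFinset z c'.2.2))) (i + 1) (Function.updateFinset ((τ (c'.1, avgRestrOfRecord F N K (i + 1) (Set.toFinite (B10Eq42TorusConstraint.bondsIn (i + 1) (s.Ω ((i + 1) + 1))ᶜ)).toFinset (Set.toFinite (B10Eq42TorusConstraint.bondsIn ((i + 1) + 1) (s.Ω ((i + 1) + 1))ᶜ)).toFinset (splitGlue (Set.toFinite (B10Eq42TorusConstraint.bondsIn (i + 1) (s.Ω ((i + 1) + 1))ᶜ)).toFinset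 (Set.toFinite (B10Eq42TorusConstraint.bondsIn (i + 1) (s.Ω (i + 1))ᶜ)).toFinset z c'.2.2))) (i + 1)).1 (Set.toFinite (B10Eq42TorusConstraint.bondsIn (i + 1) (s.Ω ((i + 1) + 1))ᶜ)).toFinset (splitGlue (Set.toFinite (B10Eq42TorusConstraint.bondsIn (i + 1) (s.Ω ((i + 1) + 1))ᶜ)).toFinset (Set.toFinite (B10Eq42TorusConstraint.bondsIn (i + 1) (s.Ω (i + 1))ᶜ)).toFinset z c'.2.2), ((τ (c'.1, avgRestrOfRecord F N K (i + 1) (Set.toFinite (B10Eq42TorusConstraint.bondsIn (i + 1) (s.Ω ((i + 1) + 1))ᶜ)).toFinset (Set.toFinite (B10Eq42TorusConstraint.bondsIn ((i + 1) + 1) (s.Ω ((i + 1) + 1))ᶜ)).toFinset (splitGlue (Set.toFinite (B10Eq42TorusConstraint.bondsIn (i + 1) (s.Ω ((i + 1) + 1))ᶜ)).toFinset (Set.toFinite (B10Eq42TorusConstraint.bondsIn (i + 1) (s.Ω (i + 1))ᶜ)).toFinset z c'.2.2))) (i + 1)).2)) (i + 1) (insA (Set.toFinite (B10Eq42TorusConstraint.bondsIn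 (i + 1) ((s.Λ ((i + 1) + 1))ᶜ ∩ s.Ω ((i + 1) + 1)))).toFinset c'.2.1 ((Function.update (τ (c'.1, avgRestrOfRecord F N K (i + 1) (Set.toFinite (B10Eq42TorusConstraint.bondsIn (i + 1) (s.Ω ((i + 1) + 1))ᶜ)).toFinset (Set.toFinite (B10Eq42TorusConstraint.bondsIn ((i + 1) + 1) (s.Ω ((i + 1) + 1))ᶜ)).toFinset (splitGlue (Set.toFinite (B10Eq42TorusConstraint.bondsIn (i + 1) (s.Ω ((i + 1) + 1))ᶜ)).toFinset (Set.toFinite (B10Eq42TorusConstraint.bondsIn (i + 1) (s.Ω (i + 1))ᶜ)).toFinset z c'.2.2))) (i + 1) (Function.updateFinset ((τ (c'.1, avgRestrOfRecord F N K (i + 1) (Set.toFinite (B10Eq42TorusConstraint.bondsIn (i + 1) (s.Ω ((i + 1) + 1))ᶜ)).toFinset (Set.toFinite (B10Eq42TorusConstraint.bondsIn ((i + 1) + 1) (s.Ω ((i + 1) + 1))ᶜ)).toFinset (splitGlue (Set.toFinite (B10Eq42TorusConstraint.bondsIn (i + 1) (s.Ω ((i + 1) + 1))ᶜ)).toFinset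 (Set.toFinite (B10Eq42TorusConstraint.bondsIn (i + 1) (s.Ω (i + 1))ᶜ)).toFinset z c'.2.2))) (i + 1)).1 (Set.toFinite (B10Eq42TorusConstraint.bondsIn (i + 1) (s.Ω ((i + 1) + 1))ᶜ)).toFinset (splitGlue (Set.toFinite (B10Eq42TorusConstraint.bondsIn (i + 1) (s.Ω ((i + 1) + 1))ᶜ)).toFinset (Set.toFinite (B10Eq42TorusConstraint.bondsIn (i + 1) (s.Ω (i + 1))ᶜ)).toFinset z c'.2.2), ((τ (c'.1, avgRestrOfRecord F N K (i + 1) (Set.toFinite (B10Eq42TorusConstraint.bondsIn (i + 1) (s.Ω ((i + 1) + 1))ᶜ)).toFinset (Set.toFinite (B10Eq42TorusConstraint.bondsIn ((i + 1) + 1) (s.Ω ((i + 1) + 1))ᶜ)).toFinset (splitGlue (Set.toFinite (B10Eq42TorusConstraint.bondsIn (i + 1) (s.Ω ((i + 1) + 1))ᶜ)).toFinset (Set.toFinite (B10Eq42TorusConstraint.bondsIn (i + 1) (s.Ω (i + 1))ᶜ)).toFinset z c'.2.2))) (i + 1)).2)) (i + 1))))) (i + 1)).1 b) = z := by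
        intro c' z
        funext b
        simp only [Function.update_self]
        show Function.updateFinset ((τ (c'.1, avgRestrOfRecord F N K (i + 1) (Set.toFinite (B10Eq42TorusConstraint.bondsIn (i + 1) (s.Ω ((i + 1) + 1))ᶜ)).toFinset (Set.toFinite (B10Eq42TorusConstraint.bondsIn ((i + 1) + 1) (s.Ω ((i + 1) + 1))ᶜ)).toFinset (splitGlue (Set.toFinite (B10Eq42TorusConstraint.bondsIn (i + 1) (s.Ω ((i + 1) + 1))ᶜ)).toFinset (Set.toFinite (B10Eq42TorusConstraint.bondsIn (i + 1) (s.Ω (i + 1))ᶜ)).toFinset z c'.2.2))) (i + 1)).1 (Set.toFinite (B10Eq42TorusConstraint.bondsIn (i + 1) (s.Ω ((i + 1) + 1))ᶜ)).toFinset (splitGlue (Set.toFinite (B10Eq42TorusConstraint.bondsIn (i + 1) (s.Ω ((i + 1) + 1))ᶜ)).toFinset (Set.toFinite (B10Eq42TorusConstraint.bondsIn (i + 1) (s.Ω (i + 1))ᶜ)).toFinset z c'.2.2) (b : PBond (F.P K) (i + 1)) = z b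
        simp only [Function.updateFinset_def]
        rw [dif_pos (hsub b.2)]
        exact splitGlue_apply_mem _ _ z c'.2.2 ⟨(b : PBond (F.P K) (i + 1)), hsub b.2⟩ b.2
      -- (1) generation `i+1` peeled off: §2 with `Ψ := 𝐓_{i+1}(s,S)[Φ]`
      have hstep := lintegral_genOp_genDataOfRecord_le ν M g K W s S (i + 1) (hdec := hdecA)
        (hζm (i + 1)) (hζ0 (i + 1)) (hζ1 (i + 1)) (hwm (i + 1)) (hw0 (i + 1)) (ŵ (i + 1)) (hdom (i + 1)) (hBm (i + 1)) (hB0 (i + 1)) τ hτ hτz c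
      rw [tkBranchOfRecord_succ]
      refine hstep.trans ?_
      -- (2) the generic step: Tonelli over the A-fibre, the splitting of `Haar^sV`, and the induction hypothesis at the glued template
      have hH : Measurable (Function.uncurry fun (y : (↥(Set.toFinite (B10Eq42TorusConstraint.bondsIn (i + 1) (s.Ω ((i + 1) + 1))ᶜ)).toFinset → SU N)) (a : (↥(Set.toFinite (B10Eq42TorusConstraint.bondsIn (i + 1) ((s.Λ ((i + 1) + 1))ᶜ ∩ s.Ω ((i + 1) + 1)))).toFinset → V)) => ENNReal.ofReal (tkBranchOfRecord F N V ν M g K W s S (i + 1) Φ (Function.update (Function.update (τ (c, avgRestrOfRecord F N K (i + 1) (Set.toFinite (B10Eq42TorusConstraint.bondsIn (i + 1) (s.Ω ((i + 1) + 1))ᶜ)).toFinset (Set.toFinite (B10Eq42TorusConstraint.bondsIn ((i + 1) + 1) (s.Ω ((i + 1) + 1))ᶜ)).toFinset y)) (i + 1) (Function.updateFinset ((τ (c, avgRestrOfRecord F N K (i + 1) (Set.toFinite (B10Eq42TorusConstraint.bondsIn (i + 1) (s.Ω ((i + 1) + 1))ᶜ)).toFinset (Set.toFinite (B10Eq42TorusConstraint.bondsIn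 ((i + 1) + 1) (s.Ω ((i + 1) + 1))ᶜ)).toFinset y)) (i + 1)).1 (Set.toFinite (B10Eq42TorusConstraint.bondsIn (i + 1) (s.Ω ((i + 1) + 1))ᶜ)).toFinset y, ((τ (c, avgRestrOfRecord F N K (i + 1) (Set.toFinite (B10Eq42TorusConstraint.bondsIn (i + 1) (s.Ω ((i + 1) + 1))ᶜ)).toFinset (Set.toFinite (B10Eq42TorusConstraint.bondsIn ((i + 1) + 1) (s.Ω ((i + 1) + 1))ᶜ)).toFinset y)) (i + 1)).2)) (i + 1) (insA (Set.toFinite (B10Eq42TorusConstraint.bondsIn (i + 1) ((s.Λ ((i + 1) + 1))ᶜ ∩ s.Ω ((i + 1) + 1)))).toFinset a ((Function.update (τ (c, avgRestrOfRecord F N K (i + 1) (Set.toFinite (B10Eq42TorusConstraint.bondsIn (i + 1) (s.Ω ((i + 1) + 1))ᶜ)).toFinset (Set.toFinite (B10Eq42TorusConstraint.bondsIn ((i + 1) + 1) (s.Ω ((i + 1) + 1))ᶜ)).toFinset y)) (i + 1) (Function.updateFinset ((τ (c, avgRestrOfRecord F N K (i + 1) (Set.toFinite (B10Eq42TorusConstraint.bondsIn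 (i + 1) (s.Ω ((i + 1) + 1))ᶜ)).toFinset (Set.toFinite (B10Eq42TorusConstraint.bondsIn ((i + 1) + 1) (s.Ω ((i + 1) + 1))ᶜ)).toFinset y)) (i + 1)).1 (Set.toFinite (B10Eq42TorusConstraint.bondsIn (i + 1) (s.Ω ((i + 1) + 1))ᶜ)).toFinset y, ((τ (c, avgRestrOfRecord F N K (i + 1) (Set.toFinite (B10Eq42TorusConstraint.bondsIn (i + 1) (s.Ω ((i + 1) + 1))ᶜ)).toFinset (Set.toFinite (B10Eq42TorusConstraint.bondsIn ((i + 1) + 1) (s.Ω ((i + 1) + 1))ᶜ)).toFinset y)) (i + 1)).2)) (i + 1)))))) :=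
        ENNReal.measurable_ofReal.comp ((hBm (i + 1)).comp (hΩ₂m.comp (measurable_const.prodMk measurable_id)))
      refine (lintegral_lintegral_mul_le_of_split (HaarData.haar : Measure (SU N)) _ (Set.toFinite (B10Eq42TorusConstraint.bondsIn (i + 1) (s.Ω ((i + 1) + 1))ᶜ)).toFinset (Set.toFinite (B10Eq42TorusConstraint.bondsIn (i + 1) (s.Ω (i + 1))ᶜ)).toFinset hsub
        (H := fun (y : (↥(Set.toFinite (B10Eq42TorusConstraint.bondsIn (i + 1) (s.Ω ((i + 1) + 1))ᶜ)).toFinset → SU N)) (a : (↥(Set.toFinite (B10Eq42TorusConstraint.bondsIn (i + 1) ((s.Λ ((i + 1) + 1))ᶜ ∩ s.Ω ((i + 1) + 1)))).toFinset → V)) => ENNReal.ofReal (tkBranchOfRecord F N V ν M g K W s S (i + 1) Φ (Function.update (Function.update (τ (c, avgRestrOfRecord F N K (i + 1) (Set.toFinite (B10Eq42TorusConstraint.bondsIn (i + 1) (s.Ω ((i + 1) + 1))ᶜ)).toFinset (Set.toFinite (B10Eq42TorusConstraint.bondsIn ((i + 1) + 1) (s.Ω ((i + 1) + 1))ᶜ)).toFinset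 y)) (i + 1) (Function.updateFinset ((τ (c, avgRestrOfRecord F N K (i + 1) (Set.toFinite (B10Eq42TorusConstraint.bondsIn (i + 1) (s.Ω ((i + 1) + 1))ᶜ)).toFinset (Set.toFinite (B10Eq42TorusConstraint.bondsIn ((i + 1) + 1) (s.Ω ((i + 1) + 1))ᶜ)).toFinset y)) (i + 1)).1 (Set.toFinite (B10Eq42TorusConstraint.bondsIn (i + 1) (s.Ω ((i + 1) + 1))ᶜ)).toFinset y, ((τ (c, avgRestrOfRecord F N K (i + 1) (Set.toFinite (B10Eq42TorusConstraint.bondsIn (i + 1) (s.Ω ((i + 1) + 1))ᶜ)).toFinset (Set.toFinite (B10Eq42TorusConstraint.bondsIn ((i + 1) + 1) (s.Ω ((i + 1) + 1))ᶜ)).toFinset y)) (i + 1)).2)) (i + 1) (insA (Set.toFinite (B10Eq42TorusConstraint.bondsIn (i + 1) ((s.Λ ((i + 1) + 1))ᶜ ∩ s.Ω ((i + 1) + 1)))).toFinset a ((Function.update (τ (c, avgRestrOfRecord F N K (i + 1) (Set.toFinite (B10Eq42TorusConstraint.bondsIn (i + 1) (s.Ω ((i + 1) + 1))ᶜ)).toFinset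 (Set.toFinite (B10Eq42TorusConstraint.bondsIn ((i + 1) + 1) (s.Ω ((i + 1) + 1))ᶜ)).toFinset y)) (i + 1) (Function.updateFinset ((τ (c, avgRestrOfRecord F N K (i + 1) (Set.toFinite (B10Eq42TorusConstraint.bondsIn (i + 1) (s.Ω ((i + 1) + 1))ᶜ)).toFinset (Set.toFinite (B10Eq42TorusConstraint.bondsIn ((i + 1) + 1) (s.Ω ((i + 1) + 1))ᶜ)).toFinset y)) (i + 1)).1 (Set.toFinite (B10Eq42TorusConstraint.bondsIn (i + 1) (s.Ω ((i + 1) + 1))ᶜ)).toFinset y, ((τ (c, avgRestrOfRecord F N K (i + 1) (Set.toFinite (B10Eq42TorusConstraint.bondsIn (i + 1) (s.Ω ((i + 1) + 1))ᶜ)).toFinset (Set.toFinite (B10Eq42TorusConstraint.bondsIn ((i + 1) + 1) (s.Ω ((i + 1) + 1))ᶜ)).toFinset y)) (i + 1)).2)) (i + 1)))))) hH (hŵm (i + 1)) (hCw (i + 1))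
        (Mi := ENNReal.ofReal CΦ * ∏ j ∈ Finset.range (i + 1), Cw j) fun r a => ?_).trans (le_of_eq ?_)
      · exact ih (Γ × ((↥(Set.toFinite (B10Eq42TorusConstraint.bondsIn (i + 1) ((s.Λ ((i + 1) + 1))ᶜ ∩ s.Ω ((i + 1) + 1)))).toFinset → V) × ({b : ↥(Set.toFinite (B10Eq42TorusConstraint.bondsIn (i + 1) (s.Ω ((i + 1) + 1))ᶜ)).toFinset // (b : PBond (F.P K) (i + 1)) ∉ (Set.toFinite (B10Eq42TorusConstraint.bondsIn (i + 1) (s.Ω (i + 1))ᶜ)).toFinset} → SU N))) (fun q => (Function.update (Function.update (τ (q.1.1, avgRestrOfRecord F N K (i + 1) (Set.toFinite (B10Eq42TorusConstraint.bondsIn (i + 1) (s.Ω ((i + 1) + 1))ᶜ)).toFinset (Set.toFinite (B10Eq42TorusConstraint.bondsIn ((i + 1) + 1) (s.Ω ((i + 1) + 1))ᶜ)).toFinset (splitGlue (Set.toFinite (B10Eq42TorusConstraint.bondsIn (i + 1) (s.Ω ((i + 1) + 1))ᶜ)).toFinset (Set.toFinite (B10Eq42TorusConstraint.bondsIn (i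 + 1) (s.Ω (i + 1))ᶜ)).toFinset q.2 q.1.2.2))) (i + 1) (Function.updateFinset ((τ (q.1.1, avgRestrOfRecord F N K (i + 1) (Set.toFinite (B10Eq42TorusConstraint.bondsIn (i + 1) (s.Ω ((i + 1) + 1))ᶜ)).toFinset (Set.toFinite (B10Eq42TorusConstraint.bondsIn ((i + 1) + 1) (s.Ω ((i + 1) + 1))ᶜ)).toFinset (splitGlue (Set.toFinite (B10Eq42TorusConstraint.bondsIn (i + 1) (s.Ω ((i + 1) + 1))ᶜ)).toFinset (Set.toFinite (B10Eq42TorusConstraint.bondsIn (i + 1) (s.Ω (i + 1))ᶜ)).toFinset q.2 q.1.2.2))) (i + 1)).1 (Set.toFinite (B10Eq42TorusConstraint.bondsIn (i + 1) (s.Ω ((i + 1) + 1))ᶜ)).toFinset (splitGlue (Set.toFinite (B10Eq42TorusConstraint.bondsIn (i + 1) (s.Ω ((i + 1) + 1))ᶜ)).toFinset (Set.toFinite (B10Eq42TorusConstraint.bondsIn (i + 1) (s.Ω (i + 1))ᶜ)).toFinset q.2 q.1.2.2), ((τ (q.1.1, avgRestrOfRecord F N K (i + 1) (Set.toFinite (B10Eq42TorusConstraint.bondsIn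 (i + 1) (s.Ω ((i + 1) + 1))ᶜ)).toFinset (Set.toFinite (B10Eq42TorusConstraint.bondsIn ((i + 1) + 1) (s.Ω ((i + 1) + 1))ᶜ)).toFinset (splitGlue (Set.toFinite (B10Eq42TorusConstraint.bondsIn (i + 1) (s.Ω ((i + 1) + 1))ᶜ)).toFinset (Set.toFinite (B10Eq42TorusConstraint.bondsIn (i + 1) (s.Ω (i + 1))ᶜ)).toFinset q.2 q.1.2.2))) (i + 1)).2)) (i + 1) (insA (Set.toFinite (B10Eq42TorusConstraint.bondsIn (i + 1) ((s.Λ ((i + 1) + 1))ᶜ ∩ s.Ω ((i + 1) + 1)))).toFinset q.1.2.1 ((Function.update (τ (q.1.1, avgRestrOfRecord F N K (i + 1) (Set.toFinite (B10Eq42TorusConstraint.bondsIn (i + 1) (s.Ω ((i + 1) + 1))ᶜ)).toFinset (Set.toFinite (B10Eq42TorusConstraint.bondsIn ((i + 1) + 1) (s.Ω ((i + 1) + 1))ᶜ)).toFinset (splitGlue (Set.toFinite (B10Eq42TorusConstraint.bondsIn (i + 1) (s.Ω ((i + 1) + 1))ᶜ)).toFinset (Set.toFinite (B10Eq42TorusConstraint.bondsIn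 (i + 1) (s.Ω (i + 1))ᶜ)).toFinset q.2 q.1.2.2))) (i + 1) (Function.updateFinset ((τ (q.1.1, avgRestrOfRecord F N K (i + 1) (Set.toFinite (B10Eq42TorusConstraint.bondsIn (i + 1) (s.Ω ((i + 1) + 1))ᶜ)).toFinset (Set.toFinite (B10Eq42TorusConstraint.bondsIn ((i + 1) + 1) (s.Ω ((i + 1) + 1))ᶜ)).toFinset (splitGlue (Set.toFinite (B10Eq42TorusConstraint.bondsIn (i + 1) (s.Ω ((i + 1) + 1))ᶜ)).toFinset (Set.toFinite (B10Eq42TorusConstraint.bondsIn (i + 1) (s.Ω (i + 1))ᶜ)).toFinset q.2 q.1.2.2))) (i + 1)).1 (Set.toFinite (B10Eq42TorusConstraint.bondsIn (i + 1) (s.Ω ((i + 1) + 1))ᶜ)).toFinset (splitGlue (Set.toFinite (B10Eq42TorusConstraint.bondsIn (i + 1) (s.Ω ((i + 1) + 1))ᶜ)).toFinset (Set.toFinite (B10Eq42TorusConstraint.bondsIn (i + 1) (s.Ω (i + 1))ᶜ)).toFinset q.2 q.1.2.2), ((τ (q.1.1, avgRestrOfRecord F N K (i + 1) (Set.toFinite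 (B10Eq42TorusConstraint.bondsIn (i + 1) (s.Ω ((i + 1) + 1))ᶜ)).toFinset (Set.toFinite (B10Eq42TorusConstraint.bondsIn ((i + 1) + 1) (s.Ω ((i + 1) + 1))ᶜ)).toFinset (splitGlue (Set.toFinite (B10Eq42TorusConstraint.bondsIn (i + 1) (s.Ω ((i + 1) + 1))ᶜ)).toFinset (Set.toFinite (B10Eq42TorusConstraint.bondsIn (i + 1) (s.Ω (i + 1))ᶜ)).toFinset q.2 q.1.2.2))) (i + 1)).2)) (i + 1))))) hτ'm hτ'z (c, (a, r))
      · rw [Finset.prod_range_succ _ (i + 1), mul_comm (Cw (i + 1)), mul_assoc]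

end Induction


/-! ## §5  ★★★ The consumer theorem: the old branches at the base configuration are `dU_k`-integrable -/

section Consumer

variable {F : T4Family} {N : ℕ} [NeZero N] {V : Type} [NormedAddCommGroup V] [InnerProductSpace ℝ V] [FiniteDimensional ℝ V]
  [MeasurableSpace V] [BorelSpace V]
variable (ν : Stage7Numerics) (M : ℕ) (g : ℕ → ℝ) (K : ℕ) (W : TkWeights F N V K)

/-- **★★★ THE OLD BRANCHES ARE `dU_k`-INTEGRABLE UNDER STRUCTURAL LAWS OF THE DATA** — the shape of this seat's binder `hIB` (p569094 and its graph editions): for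
11a's 𝐓-weights with `ζ_j` measurable in `[0, 1]` and A-fibre weights `w_j ≥ 0` measurable and dominated on every configuration by an integrable function `ŵ_j` of the
fluctuation variables they integrate (`∫⁻ ŵ_j ≤ Cw j`), and an operand `Φ` measurable with `0 ≤ Φ ≤ CΦ`, the branch `U₀ ↦ 𝐓_k(s,S)[Φ](base_k U₀)` is integrable for product
Haar at level `k`, with mass `≤ CΦ · ∏_{j<k} Cw j`.  (Level `0`: the operand itself.  Level `k = i+1`: §4 at the template `(r, z) ↦ base_k(glue z r)` — the produced
variables of the last generation are among ALL level-`k` bonds.) [cite: Balaban1988Convergent, (2.18) p.257, (2.20)–(2.21) p.258, (3.23)–(3.24) p.270; Balaban1985Averaging, (10) p.19] -/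
theorem integrable_tkBranchOfRecord_baseCfg_of_dominated {n : ℕ} (s : SeqOfRecord F ν M g K n) (S : ℕ → Set (Site (F.P K) 0))
    (hζm : ∀ j, Measurable (W.ζ j (s.Ω (j + 1))ᶜ)) (hζ0 : ∀ j ω, 0 ≤ W.ζ j (s.Ω (j + 1))ᶜ ω) (hζ1 : ∀ j ω, W.ζ j (s.Ω (j + 1))ᶜ ω ≤ 1)
    (hwm : ∀ j, Measurable (W.w j (s.Λ (j + 1)) ((s.Λ (j + 1))ᶜ ∩ s.Ω (j + 1)) (S (j + 1))))
    (hw0 : ∀ j ω, 0 ≤ W.w j (s.Λ (j + 1)) ((s.Λ (j + 1))ᶜ ∩ s.Ω (j + 1)) (S (j + 1)) ω)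
    (ŵ : (j : ℕ) → (↥(Set.toFinite (B10Eq42TorusConstraint.bondsIn j ((s.Λ (j + 1))ᶜ ∩ s.Ω (j + 1)))).toFinset → V) → ℝ≥0∞) (hŵm : ∀ j, Measurable (ŵ j))
    (hdom : ∀ j ω, ENNReal.ofReal (W.w j (s.Λ (j + 1)) ((s.Λ (j + 1))ᶜ ∩ s.Ω (j + 1)) (S (j + 1)) ω) ≤ ŵ j (fun b : ↥(Set.toFinite (B10Eq42TorusConstraint.bondsIn j ((s.Λ (j + 1))ᶜ ∩ s.Ω (j + 1)))).toFinset => (ω j).2 b))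
    (Cw : ℕ → ℝ≥0) (hCw : ∀ j, ∫⁻ a, ŵ j a ∂(Measure.pi fun _ : ↥(Set.toFinite (B10Eq42TorusConstraint.bondsIn j ((s.Λ (j + 1))ᶜ ∩ s.Ω (j + 1)))).toFinset => (volume : Measure V)) ≤ Cw j)
    {Φ : MultiCfg (F.P K) (SU N) V → ℝ} (hΦm : Measurable Φ) (hΦ0 : ∀ ω, 0 ≤ Φ ω) (CΦ : ℝ) (hΦle : ∀ ω, Φ ω ≤ CΦ) (k : ℕ) :
    Integrable (fun U₀ : GaugeField (F.P K) k (SU N) => tkBranchOfRecord F N V ν M g K W s S k Φ (baseCfg k U₀)) (fieldMeasure (F.P K) k (SU N)) := by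
  haveI : IsProbabilityMeasure (HaarData.haar : Measure (SU N)) := HaarData.isProb
  haveI : IsProbabilityMeasure (fieldMeasure (F.P K) k (SU N)) := Missing.isProbabilityMeasure_fieldMeasure (F.P K) k
  have hBm : Measurable (fun U₀ : GaugeField (F.P K) k (SU N) => tkBranchOfRecord F N V ν M g K W s S k Φ (baseCfg k U₀)) :=
    (measurable_tkBranchOfRecord ν M g K W s S hζm hwm hΦm k).comp (measurable_baseCfg k)
  have hB0 : ∀ U₀ : GaugeField (F.P K) k (SU N), 0 ≤ tkBranchOfRecord F N V ν M g K W s S k Φ (baseCfg k U₀) := fun U₀ =>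
    tkBranchOfRecord_nonneg' ν M g K W s S hζ0 hw0 hΦ0 k _
  refine ⟨hBm.aestronglyMeasurable, ?_⟩
  rw [hasFiniteIntegral_iff_enorm]
  have henorm : ∀ U₀ : GaugeField (F.P K) k (SU N), ‖tkBranchOfRecord F N V ν M g K W s S k Φ (baseCfg k U₀)‖ₑ =
      ENNReal.ofReal (tkBranchOfRecord F N V ν M g K W s S k Φ (baseCfg k U₀)) := fun U₀ => Real.enorm_eq_ofReal (hB0 U₀)
  simp only [henorm]
  cases k with
  | zero =>
      -- level `0`: the operand itself, bounded by `CΦ` on a probability space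
      calc ∫⁻ U₀, ENNReal.ofReal (tkBranchOfRecord F N V ν M g K W s S 0 Φ (baseCfg 0 U₀)) ∂fieldMeasure (F.P K) 0 (SU N)
          ≤ ∫⁻ _U₀, ENNReal.ofReal CΦ ∂fieldMeasure (F.P K) 0 (SU N) := lintegral_mono fun U₀ => ENNReal.ofReal_le_ofReal (hΦle _)
        _ = ENNReal.ofReal CΦ := by rw [lintegral_const, measure_univ, mul_one]
        _ < ⊤ := ENNReal.ofReal_lt_top
  | succ i =>
      -- level `i+1`: §4 at the template `(r, z) ↦ base_{i+1} (glue z r)` over ALL level-`(i+1)` bonds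
      letI hdecA : DecidableEq (PBond (F.P K) (i + 1)) := fun a b => Classical.propDecidable (a = b)
      have hsub : (Set.toFinite (B10Eq42TorusConstraint.bondsIn (i + 1) (s.Ω (i + 1))ᶜ)).toFinset ⊆ (Finset.univ : Finset (PBond (F.P K) (i + 1))) := fun _ _ => Finset.mem_univ _
      -- product Haar on all bonds, read on `↥Finset.univ`
      let E : (↥(Finset.univ : Finset (PBond (F.P K) (i + 1))) → SU N) ≃ᵐ GaugeField (F.P K) (i + 1) (SU N) :=
        MeasurableEquiv.piCongrLeft (fun _ : PBond (F.P K) (i + 1) => SU N) (Equiv.subtypeUnivEquiv (fun b => Finset.mem_univ b))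
      have mpE : MeasurePreserving E (Measure.pi fun _ : ↥(Finset.univ : Finset (PBond (F.P K) (i + 1))) => (HaarData.haar : Measure (SU N)))
          (fieldMeasure (F.P K) (i + 1) (SU N)) := by
        unfold fieldMeasure
        exact measurePreserving_piCongrLeft (fun _ : PBond (F.P K) (i + 1) => (HaarData.haar : Measure (SU N))) _
      have hE : ∀ (y : ↥(Finset.univ : Finset (PBond (F.P K) (i + 1))) → SU N) (b : PBond (F.P K) (i + 1)), E y b = y ⟨b, Finset.mem_univ b⟩ :=
        fun y b => by
          change E y (Equiv.subtypeUnivEquiv (fun b => Finset.mem_univ b) ⟨b, Finset.mem_univ b⟩) = y ⟨b, Finset.mem_univ b⟩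
          exact MeasurableEquiv.piCongrLeft_apply_apply _ (β := fun _ : PBond (F.P K) (i + 1) => SU N) y ⟨b, Finset.mem_univ b⟩
      -- the template and its two properties
      have hτm : Measurable (fun q : ({b : ↥(Finset.univ : Finset (PBond (F.P K) (i + 1))) // (b : PBond (F.P K) (i + 1)) ∉ (Set.toFinite (B10Eq42TorusConstraint.bondsIn (i + 1) (s.Ω (i + 1))ᶜ)).toFinset} → SU N) ×
          (↥(Set.toFinite (B10Eq42TorusConstraint.bondsIn (i + 1) (s.Ω (i + 1))ᶜ)).toFinset → SU N) => baseCfg (V := V) (i + 1) (E (splitGlue Finset.univ (Set.toFinite (B10Eq42TorusConstraint.bondsIn (i + 1) (s.Ω (i + 1))ᶜ)).toFinset q.2 q.1))) :=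
        (measurable_baseCfg (i + 1)).comp (E.measurable.comp ((measurable_splitGlue _ _).comp (measurable_snd.prodMk measurable_fst)))
      have hτz : ∀ (r : {b : ↥(Finset.univ : Finset (PBond (F.P K) (i + 1))) // (b : PBond (F.P K) (i + 1)) ∉ (Set.toFinite (B10Eq42TorusConstraint.bondsIn (i + 1) (s.Ω (i + 1))ᶜ)).toFinset} → SU N) (z : ↥(Set.toFinite (B10Eq42TorusConstraint.bondsIn (i + 1) (s.Ω (i + 1))ᶜ)).toFinset → SU N),
          (fun b : ↥(Set.toFinite (B10Eq42TorusConstraint.bondsIn (i + 1) (s.Ω (i + 1))ᶜ)).toFinset => ((baseCfg (V := V) (i + 1) (E (splitGlue Finset.univ (Set.toFinite (B10Eq42TorusConstraint.bondsIn (i + 1) (s.Ω (i + 1))ᶜ)).toFinset z r))) (i + 1)).1 b) = z := by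
        intro r z
        funext b
        show ((baseCfg (V := V) (i + 1) (E (splitGlue Finset.univ (Set.toFinite (B10Eq42TorusConstraint.bondsIn (i + 1) (s.Ω (i + 1))ᶜ)).toFinset z r))) (i + 1)).1 b = z b
        rw [baseCfg_fst_self, hE]
        exact splitGlue_apply_mem _ _ z r ⟨(b : PBond (F.P K) (i + 1)), Finset.mem_univ _⟩ b.2
      have key := lintegral_tkBranchOfRecord_template_le ν M g K W s S hζm hζ0 hζ1 hwm hw0 ŵ hŵm hdom (fun j => (Cw j : ℝ≥0∞)) hCw hΦm hΦ0 CΦ hΦle i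
        (({b : ↥(Finset.univ : Finset (PBond (F.P K) (i + 1))) // (b : PBond (F.P K) (i + 1)) ∉ (Set.toFinite (B10Eq42TorusConstraint.bondsIn (i + 1) (s.Ω (i + 1))ᶜ)).toFinset} → SU N))
        (fun q => baseCfg (V := V) (i + 1) (E (splitGlue Finset.univ (Set.toFinite (B10Eq42TorusConstraint.bondsIn (i + 1) (s.Ω (i + 1))ᶜ)).toFinset q.2 q.1))) hτm hτz
      -- split the full Haar integral along the glue map and bound
      have hG : Measurable (fun y : ↥(Finset.univ : Finset (PBond (F.P K) (i + 1))) → SU N =>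
          ENNReal.ofReal (tkBranchOfRecord F N V ν M g K W s S (i + 1) Φ (baseCfg (i + 1) (E y)))) :=
        ENNReal.measurable_ofReal.comp (hBm.comp E.measurable)
      have hsplit := measurePreserving_splitGlue (HaarData.haar : Measure (SU N)) (Finset.univ : Finset (PBond (F.P K) (i + 1))) (Set.toFinite (B10Eq42TorusConstraint.bondsIn (i + 1) (s.Ω (i + 1))ᶜ)).toFinset hsub
      calc ∫⁻ U₀, ENNReal.ofReal (tkBranchOfRecord F N V ν M g K W s S (i + 1) Φ (baseCfg (i + 1) U₀)) ∂fieldMeasure (F.P K) (i + 1) (SU N)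
          = ∫⁻ y, ENNReal.ofReal (tkBranchOfRecord F N V ν M g K W s S (i + 1) Φ (baseCfg (i + 1) (E y)))
              ∂(Measure.pi fun _ : ↥(Finset.univ : Finset (PBond (F.P K) (i + 1))) => (HaarData.haar : Measure (SU N))) :=
            (mpE.lintegral_comp (ENNReal.measurable_ofReal.comp hBm)).symm
        _ = ∫⁻ q, ENNReal.ofReal (tkBranchOfRecord F N V ν M g K W s S (i + 1) Φ (baseCfg (i + 1) (E (splitGlue Finset.univ (Set.toFinite (B10Eq42TorusConstraint.bondsIn (i + 1) (s.Ω (i + 1))ᶜ)).toFinset q.1 q.2))))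
              ∂((Measure.pi fun _ : ↥(Set.toFinite (B10Eq42TorusConstraint.bondsIn (i + 1) (s.Ω (i + 1))ᶜ)).toFinset => (HaarData.haar : Measure (SU N))).prod
                (Measure.pi fun _ : {b : ↥(Finset.univ : Finset (PBond (F.P K) (i + 1))) // (b : PBond (F.P K) (i + 1)) ∉ (Set.toFinite (B10Eq42TorusConstraint.bondsIn (i + 1) (s.Ω (i + 1))ᶜ)).toFinset} => (HaarData.haar : Measure (SU N)))) :=
            (hsplit.lintegral_comp hG).symm
        _ = ∫⁻ r, ∫⁻ z, ENNReal.ofReal (tkBranchOfRecord F N V ν M g K W s S (i + 1) Φ (baseCfg (i + 1) (E (splitGlue Finset.univ (Set.toFinite (B10Eq42TorusConstraint.bondsIn (i + 1) (s.Ω (i + 1))ᶜ)).toFinset z r))))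
              ∂(Measure.pi fun _ : ↥(Set.toFinite (B10Eq42TorusConstraint.bondsIn (i + 1) (s.Ω (i + 1))ᶜ)).toFinset => (HaarData.haar : Measure (SU N)))
              ∂(Measure.pi fun _ : {b : ↥(Finset.univ : Finset (PBond (F.P K) (i + 1))) // (b : PBond (F.P K) (i + 1)) ∉ (Set.toFinite (B10Eq42TorusConstraint.bondsIn (i + 1) (s.Ω (i + 1))ᶜ)).toFinset} => (HaarData.haar : Measure (SU N))) :=
            lintegral_prod_symm _ (hG.comp (measurable_splitGlue _ _)).aemeasurable
        _ ≤ ∫⁻ _r, ENNReal.ofReal CΦ * ∏ j ∈ Finset.range (i + 1), (Cw j : ℝ≥0∞)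
              ∂(Measure.pi fun _ : {b : ↥(Finset.univ : Finset (PBond (F.P K) (i + 1))) // (b : PBond (F.P K) (i + 1)) ∉ (Set.toFinite (B10Eq42TorusConstraint.bondsIn (i + 1) (s.Ω (i + 1))ᶜ)).toFinset} => (HaarData.haar : Measure (SU N))) :=
            lintegral_mono fun r => key r
        _ = ENNReal.ofReal CΦ * ∏ j ∈ Finset.range (i + 1), (Cw j : ℝ≥0∞) := by rw [lintegral_const, measure_univ, mul_one]
        _ < ⊤ := ENNReal.mul_lt_top ENNReal.ofReal_lt_top (ENNReal.prod_lt_top fun j _ => ENNReal.coe_lt_top)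

end Consumer

end Summit.QuantumFields.YangMills.Theorems.BalabanUVNodesN11TkBranchMassBound

end
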